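import Summits.QuantumFields.YangMills.Theorems.BalabanUVNodesN09RegularOnOfLoopSmallThresholdsAnyCrit
import Summits.QuantumFields.YangMills.Theorems.BalabanUVNodesN09LocalSupportSetAnyCrit
import Summits.QuantumFields.YangMills.Theorems.BalabanUVNodesN09DensityContinuousOffThresholdsAnyCrit
import Summits.QuantumFields.YangMills.Theorems.BalabanUVNodesN09BetaInputMeasurableOverTcan
import Summits.QuantumFields.YangMills.Theorems.BalabanUVNodesN09SelectorContinuousOfThm1TwoRadii
import Summits.QuantumFields.YangMills.Theorems.BalabanUVNodesN09GaugeFixingTermContinuousOnAdmissible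

/-!
# NODE N09 [B12] · ROAD B CLOSES FOR THE OFFER: the analytic inclusion `hreg_k : domAlt_{k+1} ⊆ regSetOfRecord K k ρ_k` for the Sel β-input
# `ρ_k = χ^{(2.9),Sel}_k·exp[−GF_k∕g_k² + A_k]` over `TcanOfRecord`, from [B11] Thm 1's two-radii binders, the step's `A_k`-continuity and NUMERICS — nothing else displayed

Cell `pub-ymgap` (YM-PLAN Track A), DAG node N09 [Balaban1987RG1] (= [I]); width seat `pub-ymgap-dag-n09-w3` g6, FILE 7; count-neutral helper keyed to K1⁹
`StabilityBRunRowsAtRecordR13SepCoPHV` = stmt-QuantumFields-27364 (`--kind proof --supports … --as helper`).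

WHY.  The six files before this one (g6 FILES 1–6) and the lanes they cite reduce N09's analytic inclusion on ROAD B to displayed inputs; for the OFFER `UkSel` ∕
`critCfgSelOfRecord` ∕ `chiFixed29Sel` (node00-def-K0c ∕ dag-n09-w4 g2, `Node00.SmallFieldChi29SelOfRecord`) EVERY ONE of them is now a theorem except [B11] Thm 1 and the
regularity tower's `A_k`: this file writes the one composition, so the statement can be read in one place.  INPUTS (all displayed, all located): the two-radii binders of
the N09 doors — `h11 : ∀ k ≤ K, ∀ V ∈ domAlt_k, UkExists … εbg V ∧ UniqueUkOrbit … εbg V`, `hreg8 : … Uk … εbg V ∈ bgReg … ν.εreg` ([B11] Thm 1 + (8), N07) —, the CONTINUITY of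
`A_k = effActionHT (TcanOfRecord) (chiFixed29Sel ν ε₁) K g k` ON `domAlt_k` (the tower's induction hypothesis; dag-n09-w2's lane), and NUMERICS on `εreg, εbg, ε₀, ε₁, α, α₀`.
OUTPUT: `domAltOfRecord ν K (k+1) ⊆ regSetOfRecord F N K k ρ_k ∧ HasContTransportOn F N K k ρ_k (domAltOfRecord ν K (k+1))`.  SUPPLIERS BY NAME: FILE 3
`domAlt_subset_regSetOfRecord_of_loopSmall_chi29Sel_local` (engine), FILE 4 `hρK_betaInput_chi29Sel_of_hsolν_of_numerics` (support set), FILE 5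
`hρc_betaInput_chi29Sel_local_of_continuousOn_crit` ∕ `hρC_betaInput_chi29Sel_of_continuousOn`, FILE 6 `measurable_betaInput_TcanOfRecord_chi29Sel` ((H-U)-free `hρm`), K0c
`integrable_betaInput_TcanOfRecord_chi29Sel` ((I19)), dag-n09-w1 g6 `hcritSel_domAlt_of_thm1_εbg_of_reg8` (hcrit ON the domain), dag-n09-w1 g2 `ukExists_εreg_of_h11_of_reg8` (`hsolν`),
`…N09GaugeFixingTermContinuousOnAdmissible.continuousOn_gfOfRecord_domAlt` (`GF_k`).

WHAT IS PROVED (theorems only; 0 def, 0 sorry; axioms standard).  `betaInput_chi29Sel_nonneg`, `localSupportSet_subset_domAlt_of_lt` and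
★★★ `hregSel_of_thm1_of_numerics` (one step `k < K`).

HONEST SCOPE ∕ FRAMING.  LOCATED, count-neutral COMPOSITION BY NAME — for the OFFER objects, which NO record reads yet (adopting them is def-T ∕ def-B's decision; for the
bare-choice record the same composition displays `hcrit : ContinuousOn (critCfgOfRecord …) (domAlt_{k+1})`, unsuppliable by design); [B11] Thm 1 (two radii + (8)) and the tower's
`A_k`-continuity stay DISPLAYED; the numerics are displayed smallness conditions whose joint satisfiability at a witness is the K0-numerics lane's; NOTHING of Bałaban's asserted;
`hreg` at the record ∕ (F3) ∕ `contTOn` NOT discharged; N09 NOT discharged; conjunct 1 (Lemma 4) ∕ FLAG №7 untouched; K0⁷ ∕ K1⁹ ∕ K2⁹ ∕ K3⁸ NOT closed; counts unmoved (typed 28∕28 ·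
discharged 5∕28); one finite four-torus programme at fixed `ε = L^{−K}` per run — R4 closes the conditional rung `BalabanLadder.UV` only; NOT ℝ⁴ ∕ infinite volume ∕ OS; the
Yang–Mills mass gap (Clay) is NOT proved by any of this.
-/

noncomputable section

open scoped Matrix.Norms.L2Operator Topology
open Filter Set Function MeasureTheory

namespace Summit.QuantumFields.YangMills.BalabanUVNodes.N09HregSelOfThm1OfNumerics

open Literature.MathematicalPhysics.QuantumFieldTheory.Balaban1983to89
open Literature.MathematicalPhysics.QuantumFieldTheory.Balaban1983to89.T4Continuum (T4Family)
open Literature.MathematicalPhysics.QuantumFieldTheory.Balaban1983to89.Node00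
open Literature.MathematicalPhysics.QuantumFieldTheory.Balaban1983to89.BlockAveraging (Idx loopHol)
open Literature.MathematicalPhysics.QuantumFieldTheory.Balaban1983to89.ExpMeanLog (deltaSU)
open Literature.MathematicalPhysics.QuantumFieldTheory.Balaban1983to89.FederbushMean (deltaFed)
open Summit.QuantumFields.YangMills.BalabanUVNodes.N09LocalSupportSetAtRecord (isClosed_loopLe_inter_plaqLe plaqSmall_of_mem_of_lt localSupportSet_subset_loopGuard)
open Summit.QuantumFields.YangMills.BalabanUVNodes.N09RegularOnOfLoopSmallThresholdsAnyCrit (domAlt_subset_regSetOfRecord_of_loopSmall_chi29Sel_local)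
open Summit.QuantumFields.YangMills.BalabanUVNodes.N09LocalSupportSetAnyCrit (hρK_betaInput_chi29Sel_of_hsolν_of_numerics)
open Summit.QuantumFields.YangMills.BalabanUVNodes.N09DensityContinuousOffThresholdsAnyCrit (hρc_betaInput_chi29Sel_local_of_continuousOn_crit
  hρC_betaInput_chi29Sel_of_continuousOn)
open Summit.QuantumFields.YangMills.BalabanUVNodes.N09BetaInputMeasurableOverTcan (measurable_betaInput_TcanOfRecord_chi29Sel)
open Summit.QuantumFields.YangMills.BalabanUVNodes.N09SelectorContinuousOfThm1TwoRadii (hcritSel_domAlt_of_thm1_εbg_of_reg8)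
open Summit.QuantumFields.YangMills.BalabanUVNodes.N09BackgroundRadiiTransfer (ukExists_εreg_of_h11_of_reg8)
open Summit.QuantumFields.YangMills.BalabanUVNodes.N09GaugeFixingTermContinuousOnAdmissible (continuousOn_gfOfRecord_domAlt)

variable {F : T4Family} {N : ℕ} [NeZero N] {K k : ℕ}

/-- The Sel β-input is non-negative (`0 ≤ χ^{(2.9),Sel}`, `exp > 0`). [cite: Balaban1987RG1, (0.19) p.255 (bookkeeping)] -/
theorem betaInput_chi29Sel_nonneg (ν : Stage7Numerics) (ε₁ : ℝ) (T : Transport F N) (K : ℕ) (g : ℕ → ℝ) (k : ℕ) (U : GaugeField (F.P K) k (SU N)) :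
    0 ≤ betaInputOfRecord F N T (chiFixed29Sel F N ν ε₁) K g k U :=
  mul_nonneg (chiFixed29Sel_nonneg ν ε₁ K g k U) (Real.exp_pos _).le

/-- The local support set «loops `≤ α` ∧ plaquettes `≤ B`» lies in `domAltOfRecord ν K k` when `B < ν.ε₀`. [cite: Balaban1987RG1, p.259 (bookkeeping)] -/
theorem localSupportSet_subset_domAlt_of_lt (ν : Stage7Numerics) (K k : ℕ) {α B : ℝ} (hB : B < ν.ε₀) :
    {W : GaugeField (F.P K) k (SU N) | (∀ c i, dist1 (loopHol W c i) ≤ α) ∧ ∀ p, dist1 (GaugeField.plaqHol W p) ≤ B} ⊆ domAltOfRecord F N ν K k :=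
  fun W hW => (mem_domAltOfRecord_iff F N ν K k W).2 (plaqSmall_of_mem_of_lt hB W hW)

/-- ★★★ **ROAD B CLOSES FOR THE OFFER, ONE STEP.**  For `k < K`, the Sel β-input `ρ_k = betaInputOfRecord (TcanOfRecord) (chiFixed29Sel ν ε₁) K g k` satisfies
`domAltOfRecord ν K (k+1) ⊆ regSetOfRecord F N K k ρ_k ∧ HasContTransportOn F N K k ρ_k (domAltOfRecord ν K (k+1))` — the `hreg` binder of the N09 doors at the offer —
FROM: [B11] Thm 1's two-radii binders `h11`, `hreg8` with `ν.εreg < εbg` (N07; DISPLAYED), the tower's continuity of `A_k` on `domAlt_k` (DISPLAYED), and NUMERICS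
(`0 < ε₁`; `0 < εreg < α₀` with the [B7]∕loop-guard numerics on `εreg` and `α₀`; the rider's two; the loop guard `α ≤ 1∕24`, `α < δ_N`, `157α < L^{1−d}` with `(ℓ²∕4)·B < α`;
the STRICT ordering `B < ε₀`; `((dL)²∕4)·ε₀ < δ_Fed`), where `B = 2εreg∕L² + 4·max(ε₁, 10·((d+2)L)·L^{d−1}·ε₁)`.  Everything else — (H-U), (I19), `hcrit`, the support set and
its clauses, `GF_k` — is consumed BY NAME as a theorem. [cite: Balaban1987RG1, Thm 3 p.264, p.259, (0.19) p.255, (2.3) p.265, (2.9) p.266, p.267 and (2.10) p.267; Balaban1985Variational, Thm 1 (8) p.279; Balaban1985Averaging, Prop. 2 (53) p.26] -/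
theorem hregSel_of_thm1_of_numerics (ν : Stage7Numerics) (εbg : ℝ) (hk : k < K) (g : ℕ → ℝ)
    -- the cut-off's threshold and the loop guard of road B
    {ε₁ : ℝ} (hε1 : 0 < ε₁) {α : ℝ} (hα24 : α ≤ 1 / 24) (hαδ : α < deltaSU (Fin N)) (hαL : 157 * α < (((F.P K).L : ℝ) ^ ((F.P K).d - 1))⁻¹)
    -- [B7]-numerics on `εreg`, the rider's numerics, the guard margin and the strict threshold ordering
    (hεreg : 0 < ν.εreg)
    (hε3 : (143 * (((((F.P K).d + 4 : ℕ) : ℝ)) ^ 2 / 4) ^ 2) * ν.εreg ≤ 1 / 3)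
    (hε2 : 2 * ν.εreg ≤ 2 * deltaSU (Fin N) / ((((F.P K).d + 4) * (F.P K).L : ℕ) : ℝ) ^ 2)
    (hn1 : 1640 * (2 * (((((F.P K).d + 2) * (F.P K).L : ℕ) : ℝ) * ε₁) + ((((F.P K).d + 2) * (F.P K).L : ℕ) : ℝ) ^ 2 / 4 * (2 * ν.εreg / ((F.P K).L : ℝ) ^ 2)) *
      (((F.P K).L : ℝ) ^ ((F.P K).d - 1)) ^ 2 ≤ 1)
    (hn2 : 13 * (2 * (((((F.P K).d + 2) * (F.P K).L : ℕ) : ℝ) * ε₁) + ((((F.P K).d + 2) * (F.P K).L : ℕ) : ℝ) ^ 2 / 4 * (2 * ν.εreg / ((F.P K).L : ℝ) ^ 2)) *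
      ((F.P K).L : ℝ) ^ ((F.P K).d - 1) < deltaSU (Fin N))
    (hαB : ((((F.P K).d + 2) * (F.P K).L : ℕ) : ℝ) ^ 2 / 4 *
      (2 * ν.εreg / ((F.P K).L : ℝ) ^ 2 + 4 * max ε₁ (10 * (((((F.P K).d + 2) * (F.P K).L : ℕ) : ℝ) * ε₁) * ((F.P K).L : ℝ) ^ ((F.P K).d - 1))) < α)
    (hord : 2 * ν.εreg / ((F.P K).L : ℝ) ^ 2 + 4 * max ε₁ (10 * (((((F.P K).d + 2) * (F.P K).L : ℕ) : ℝ) * ε₁) * ((F.P K).L : ℝ) ^ ((F.P K).d - 1)) < ν.ε₀)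
    -- dag-n09-w1 g6's numerics for the selector's continuity
    {α₀ : ℝ} (hlt : ν.εreg < εbg) (he : ν.εreg < α₀) (hα0 : 0 < α₀)
    (hα3 : (143 * (((((F.P K).d + 4 : ℕ) : ℝ)) ^ 2 / 4) ^ 2) * α₀ ≤ 1 / 3)
    (hα2 : 2 * α₀ ≤ 2 * deltaSU (Fin N) / ((((F.P K).d + 4) * (F.P K).L : ℕ) : ℝ) ^ 2)
    (hα24' : ((((F.P K).d + 2) * (F.P K).L : ℕ) : ℝ) ^ 2 / 4 * (2 * α₀) ≤ 1 / 24)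
    (hαL' : 157 * (((((F.P K).d + 2) * (F.P K).L : ℕ) : ℝ) ^ 2 / 4 * (2 * α₀)) < (((F.P K).L : ℝ) ^ ((F.P K).d - 1))⁻¹)
    -- `GF_k`'s numerics
    (hε₀ : 0 ≤ ν.ε₀) (hGFnum : ((((F.P K).d * (F.P K).L : ℕ) : ℝ)) ^ 2 / 4 * ν.ε₀ < deltaFed (Fin N))
    -- [B11] Thm 1, two radii (DISPLAYED; N07)
    (h11 : ∀ j, j ≤ K → ∀ V ∈ domAltOfRecord F N ν K j, UkExists F N K j εbg V ∧ UniqueUkOrbit F N K j εbg V)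
    (hreg8 : ∀ j, j ≤ K → ∀ V ∈ domAltOfRecord F N ν K j, Uk F N K j εbg V ∈ bgReg F N K j ν.εreg)
    -- the tower's step-`k` output (DISPLAYED)
    (hA : ContinuousOn (effActionHT F N (TcanOfRecord F N) (chiFixed29Sel F N ν ε₁) K g k) (domAltOfRecord F N ν K k)) :
    domAltOfRecord F N ν K (k + 1) ⊆ regSetOfRecord F N K k (betaInputOfRecord F N (TcanOfRecord F N) (chiFixed29Sel F N ν ε₁) K g k) ∧
      HasContTransportOn F N K k (betaInputOfRecord F N (TcanOfRecord F N) (chiFixed29Sel F N ν ε₁) K g k) (domAltOfRecord F N ν K (k + 1)) := by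
  have hk1 : k + 1 ≤ (F.P K).m + (F.P K).K := by simp only [T4Continuum.T4Family.P_K]; omega
  -- the by-name suppliers
  have hsolν : ∀ W ∈ domAltOfRecord F N ν K (k + 1), UkExists F N K (k + 1) ν.εreg W :=
    ukExists_εreg_of_h11_of_reg8 ν εbg K h11 hreg8 hlt.le k hk
  have hcrit : ContinuousOn (critCfgSelOfRecord F N ν K k) (domAltOfRecord F N ν K (k + 1)) :=
    hcritSel_domAlt_of_thm1_εbg_of_reg8 ν εbg K hlt he hα0 hα3 hα2 hα24' hαL' h11 hreg8 k hk
  have hGF : ContinuousOn (gfOfRecord F N K k) (domAltOfRecord F N ν K k) := continuousOn_gfOfRecord_domAlt ν hk1 hε₀ hGFnum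
  have hK₀D := localSupportSet_subset_domAlt_of_lt (F := F) (N := N) ν K k (α := α) hord
  exact domAlt_subset_regSetOfRecord_of_loopSmall_chi29Sel_local ν ν hk hα24 hαδ hαL hε1.ne'
    (measurable_betaInput_TcanOfRecord_chi29Sel ν ε₁ K g k) (integrable_betaInput_TcanOfRecord_chi29Sel ν ε₁ K g hk.le)
    (betaInput_chi29Sel_nonneg ν ε₁ (TcanOfRecord F N) K g k) (isClosed_loopLe_inter_plaqLe _ _)
    (localSupportSet_subset_loopGuard (F := F) (N := N) K k)
    (hρC_betaInput_chi29Sel_of_continuousOn ν ε₁ (TcanOfRecord F N) g (isClosed_loopLe_inter_plaqLe _ _) hK₀D hGF hA)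
    (hρK_betaInput_chi29Sel_of_hsolν_of_numerics ν hk (TcanOfRecord F N) g hε1.le hεreg hε3 hε2 hn1 hn2 hαB hsolν)
    (hρc_betaInput_chi29Sel_local_of_continuousOn_crit ν ε₁ (TcanOfRecord F N) g (B12ContinuousTransportInvarianceOn.isOpen_domAltOfRecord ν K (k + 1))
      (B12ContinuousTransportInvarianceOn.isOpen_domAltOfRecord ν K k) hK₀D hαδ (localSupportSet_subset_loopGuard (F := F) (N := N) K k) hcrit hGF hA)

end Summit.QuantumFields.YangMills.BalabanUVNodes.N09HregSelOfThm1OfNumerics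

end
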